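import Literature.Analysis.FunctionSpaces.TorusLinearisedNSExistence
import Literature.Analysis.FunctionSpaces.TorusLinearisedNSBackwardUniqueness
import Literature.Analysis.FluidPDE.TorusHeatForcedIcc
import Literature.Analysis.FluidPDE.TorusLinearisedNSVDataLimits
import HarnessLib

/-!
# The linearised Navier–Stokes equation along a smooth field on the flat torus: global solutions
# on a half-line, time translation

Function-space support file (all results proved; no definitions, no named facts), the HALF-LINE
companion of `TorusLinearisedNSExistence` (compact intervals).  Fix `ν > 0` and a velocity field `u`
jointly smooth on `[a, ∞) × T^d` with divergence-free slices.  The linearised Navier–Stokes equation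
along `u` (Constantin–Foias 1988, Ch. 14, (14.3)–(14.4); Temam 1997, Ch. VI §3.1, (3.7)–(3.11)),

`∂ₜw + (u·∇)w + (w·∇)u = νΔw − ∇q`, `div w = 0`,

has, for every smooth divergence-free mean-zero datum `w₀`, a solution `(w, q)` jointly smooth on
`[a, ∞) × T^d` with `w(a) = w₀`, `w(t)` divergence free and mean zero and `q(t)` mean zero
(`Torus.linearisedNS_exists_Ici`): the solutions on the windows `[a, a + n + 1]`
(`Torus.linearisedNS_exists`) agree on overlaps — velocities by forward uniqueness
(`Torus.linearisedNS_eq_of_eq`), mean-zero pressures because their gradients are determined by the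
velocity (`Torus.linearisedNS_pressure_sub_eq`, `Torus.eq_of_forall_sub_eq_of_hasZeroMean`) — so they
patch to a solution on the half-line (joint smoothness and the one-sided time derivative are local in
time).  `Torus.linearisedNS_comp_add_const` is the time translation of solutions (the equation is
autonomous in `t` once `u` is translated along).  As in the sibling files no predicate is introduced:
the clauses are listed separately.

## References

* P. Constantin, C. Foias, *Navier–Stokes Equations*, Chicago Lectures in Math. (1988), Ch. 14,
  (14.2)–(14.6). [`ConstantinFoiasNSE1988`]
* R. Temam, *Infinite-Dimensional Dynamical Systems in Mechanics and Physics*, 2nd ed., Springer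
  (1997), Ch. VI §3.1, (3.7)–(3.11). [`Temam1997`]
-/

open MeasureTheory Set Filter
open scoped InnerProductSpace ContDiff Topology

noncomputable section

namespace Literature.Analysis.FunctionSpaces

namespace Torus

variable {d : Type*} [Fintype d] [DecidableEq d]

/-! ### Time translation -/

omit [DecidableEq d] in
/-- **Time translation of linearised solutions.**  If `(w, q)` solves the linearised Navier–Stokes
equation along `u` on the time set `S` (jointly smooth `w`, `q`, pointwise equation with the one-sided
time derivative within `S`), then `(w(· + c), q(· + c))` solves it along `u(· + c)` on `(· + c)⁻¹' S`
(`Torus.IsSmoothSpaceTimeOn.comp_add_const`, `Torus.timeDerivWithin_comp_add_const`). [folklore] -/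
theorem linearisedNS_comp_add_const {S : Set ℝ} {ν : ℝ} {u w : ℝ → UnitAddTorus d → EuclideanSpace ℝ d}
    {q : ℝ → UnitAddTorus d → ℝ} (hw : IsSmoothSpaceTimeOn S w) (hq : IsSmoothSpaceTimeOn S q)
    (hlin : ∀ t ∈ S, ∀ x, timeDerivWithin S w t x + convect (u t) (w t) x + convect (w t) (u t) x =
      ν • laplacian (w t) x - gradient (q t) x) (c : ℝ) :
    IsSmoothSpaceTimeOn ((· + c) ⁻¹' S) (fun t => w (t + c)) ∧
      IsSmoothSpaceTimeOn ((· + c) ⁻¹' S) (fun t => q (t + c)) ∧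
      ∀ t ∈ (· + c) ⁻¹' S, ∀ x, timeDerivWithin ((· + c) ⁻¹' S) (fun s => w (s + c)) t x +
        convect (u (t + c)) (w (t + c)) x + convect (w (t + c)) (u (t + c)) x =
        ν • laplacian (w (t + c)) x - gradient (q (t + c)) x := by
  refine ⟨hw.comp_add_const c, hq.comp_add_const c, fun t ht x => ?_⟩
  rw [Literature.Analysis.FluidPDE.Torus.timeDerivWithin_comp_add_const]
  exact hlin (t + c) ht x

/-! ### Global solutions on a half-line -/

omit [DecidableEq d] in
/-- **Joint smoothness on `[a, ∞)` is read off windows.**  If `v` agrees on every window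
`[a, a + n + 1]` with a field `V n` jointly smooth there, then `v` is jointly smooth on `[a, ∞) × T^d`
(Mathlib `contDiffOn_of_locally_contDiffOn` with the open sets `(-∞, a + n + 1) × ℝ^d`). [folklore] -/
theorem isSmoothSpaceTimeOn_Ici_of_forall_window {F : Type*} [NormedAddCommGroup F] [NormedSpace ℝ F]
    {a : ℝ} {v : ℝ → UnitAddTorus d → F} {V : ℕ → ℝ → UnitAddTorus d → F}
    (hV : ∀ n : ℕ, IsSmoothSpaceTimeOn (Icc a (a + ((n : ℝ) + 1))) (V n))
    (hagree : ∀ n : ℕ, ∀ t ∈ Icc a (a + ((n : ℝ) + 1)), v t = V n t) : IsSmoothSpaceTimeOn (Ici a) v := by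
  refine contDiffOn_of_locally_contDiffOn fun z hz => ?_
  obtain ⟨t, y⟩ := z
  have ht : t ∈ Ici a := (mem_prod.1 hz).1
  obtain ⟨n, hn⟩ : ∃ n : ℕ, t < a + ((n : ℝ) + 1) :=
    ⟨⌈t - a⌉₊, by have := Nat.le_ceil (t - a); linarith⟩
  refine ⟨Iio (a + ((n : ℝ) + 1)) ×ˢ univ, isOpen_Iio.prod isOpen_univ, ⟨hn, mem_univ _⟩, ?_⟩
  have hset : (Ici a ×ˢ (univ : Set (EuclideanSpace ℝ d))) ∩ Iio (a + ((n : ℝ) + 1)) ×ˢ univ =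
      Ico a (a + ((n : ℝ) + 1)) ×ˢ univ := by
    rw [prod_inter_prod, inter_self, Ici_inter_Iio]
  rw [hset]
  exact (ContDiffOn.mono (hV n) (prod_mono Ico_subset_Icc_self subset_rfl)).congr fun z hz => by
    obtain ⟨τ, y'⟩ := z
    simp only [stLift_apply, hagree n τ (Ico_subset_Icc_self (mem_prod.1 hz).1)]

/-- **Existence of smooth solutions of the linearised Navier–Stokes equation on `[a, ∞) × T^d`.**
For `ν > 0`, a velocity field `u` jointly smooth on `[a, ∞) × T^d` with divergence-free slices, and a
smooth divergence-free mean-zero datum `w₀`, there are `w`, `q` jointly smooth on `[a, ∞) × T^d` with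
`w(t)` divergence free and mean zero, `q(t)` mean zero, `∂ₜw + (u·∇)w + (w·∇)u = νΔw − ∇q` pointwise on
`[a, ∞)` (one-sided time derivative `Torus.timeDerivWithin (Ici a)`), and `w(a) = w₀` (Constantin–Foias
1988, Ch. 14, (14.3)–(14.4); Temam 1997, Ch. VI §3.1, (3.11)).  Proof: patch the solutions on the
windows `[a, a + n + 1]` (`Torus.linearisedNS_exists`), which agree on overlaps by forward uniqueness of
the velocity (`Torus.linearisedNS_eq_of_eq`) and uniqueness of the mean-zero pressure
(`Torus.linearisedNS_pressure_sub_eq`). [cite: ConstantinFoiasNSE1988, Ch. 14 (14.3)] -/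
theorem linearisedNS_exists_Ici {ν a : ℝ} (hν : 0 < ν) {u : ℝ → UnitAddTorus d → EuclideanSpace ℝ d}
    (hu : IsSmoothSpaceTimeOn (Ici a) u) (hudiv : ∀ t ∈ Ici a, IsDivFree (u t))
    {w₀ : UnitAddTorus d → EuclideanSpace ℝ d} (hw₀ : IsSmooth w₀) (hw₀div : IsDivFree w₀)
    (hw₀mean : HasZeroMean w₀) :
    ∃ (w : ℝ → UnitAddTorus d → EuclideanSpace ℝ d) (q : ℝ → UnitAddTorus d → ℝ),
      IsSmoothSpaceTimeOn (Ici a) w ∧ IsSmoothSpaceTimeOn (Ici a) q ∧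
      (∀ t ∈ Ici a, IsDivFree (w t)) ∧ (∀ t ∈ Ici a, HasZeroMean (w t)) ∧
      (∀ t ∈ Ici a, HasZeroMean (q t)) ∧
      (∀ t ∈ Ici a, ∀ x, timeDerivWithin (Ici a) w t x + convect (u t) (w t) x +
        convect (w t) (u t) x = ν • laplacian (w t) x - gradient (q t) x) ∧
      w a = w₀ := by
  -- the windows `[a, a + (n + 1)]`
  have hlt : ∀ n : ℕ, a < a + ((n : ℝ) + 1) := fun n => by
    have : (0 : ℝ) ≤ n := n.cast_nonneg
    linarith
  have hsubI : ∀ n : ℕ, Icc a (a + ((n : ℝ) + 1)) ⊆ Ici a := fun n t ht => ht.1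
  have hwin := fun n : ℕ => linearisedNS_exists (d := d) hν (hlt n) (hu.mono (hsubI n))
    (fun t ht => hudiv t (hsubI n ht)) hw₀ hw₀div hw₀mean
  choose W Q hWs hQs hWd hWm hQm hWeq hW0 using hwin
  -- restriction of the window solutions to smaller windows
  have hrestr : ∀ n m : ℕ, n ≤ m → Icc a (a + ((n : ℝ) + 1)) ⊆ Icc a (a + ((m : ℝ) + 1)) := fun n m hnm =>
    Icc_subset_Icc_right (by have : (n : ℝ) ≤ m := Nat.cast_le.2 hnm; linarith)
  have hWeq' : ∀ n m : ℕ, n ≤ m → ∀ t ∈ Icc a (a + ((n : ℝ) + 1)), ∀ x,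
      timeDerivWithin (Icc a (a + ((n : ℝ) + 1))) (W m) t x + convect (u t) (W m t) x +
        convect (W m t) (u t) x = ν • laplacian (W m t) x - gradient (Q m t) x := fun n m hnm t ht x =>
    linearisedNS_mono (hWs m) (hWeq m) (hrestr n m hnm) (uniqueDiffOn_Icc (hlt n)) ht x
  -- consistency of the velocities (forward uniqueness) ...
  have hconsW : ∀ n m : ℕ, n ≤ m → ∀ t ∈ Icc a (a + ((n : ℝ) + 1)), W n t = W m t := by
    intro n m hnm t ht
    have ha : a ∈ Icc a (a + ((n : ℝ) + 1)) := left_mem_Icc.2 (hlt n).le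
    exact linearisedNS_eq_of_eq hν (convex_Icc _ _) (hu.mono (hsubI n)) (fun s hs => hudiv s (hsubI n hs))
      (hWs n) (hQs n) (hWd n) (hWeq n) ((hWs m).mono (hrestr n m hnm)) ((hQs m).mono (hrestr n m hnm))
      (fun s hs => hWd m s (hrestr n m hnm hs)) (hWeq' n m hnm) ha (by rw [hW0 n, hW0 m]) ht
  -- ... and of the mean-zero pressures
  have hconsQ : ∀ n m : ℕ, n ≤ m → ∀ t ∈ Icc a (a + ((n : ℝ) + 1)), Q n t = Q m t := by
    intro n m hnm t ht
    have hint : ∀ k : ℕ, ∀ s ∈ Icc a (a + ((k : ℝ) + 1)), Integrable (Q k s) volume := fun k s hs =>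
      ((hQs k).isSmooth_slice hs).continuous.integrable_unitAddTorus
    exact Literature.Analysis.FluidPDE.Torus.eq_of_forall_sub_eq_of_hasZeroMean (hint n t ht)
      (hint m t (hrestr n m hnm ht)) (hQm n t ht) (hQm m t (hrestr n m hnm ht))
      (linearisedNS_pressure_sub_eq (hQs n) ((hQs m).mono (hrestr n m hnm)) (hWeq n) (hWeq' n m hnm)
        (hconsW n m hnm) ht)
  -- the patched fields
  set idx : ℝ → ℕ := fun t => ⌈t - a⌉₊ with hidx
  have hmemidx : ∀ t ∈ Ici a, t ∈ Icc a (a + ((idx t : ℝ) + 1)) := fun t ht =>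
    ⟨ht, by have := Nat.le_ceil (t - a); simp only [hidx]; linarith⟩
  set w : ℝ → UnitAddTorus d → EuclideanSpace ℝ d := fun t => W (idx t) t with hw
  set q : ℝ → UnitAddTorus d → ℝ := fun t => Q (idx t) t with hq
  -- on each window the patched fields are the window solutions
  have hagreeW : ∀ n : ℕ, ∀ t ∈ Icc a (a + ((n : ℝ) + 1)), w t = W n t := by
    intro n t ht
    simp only [hw]
    rcases le_total (idx t) n with h | h
    · exact hconsW (idx t) n h t (hmemidx t ht.1)
    · exact (hconsW n (idx t) h t ht).symm
  have hagreeQ : ∀ n : ℕ, ∀ t ∈ Icc a (a + ((n : ℝ) + 1)), q t = Q n t := by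
    intro n t ht
    simp only [hq]
    rcases le_total (idx t) n with h | h
    · exact hconsQ (idx t) n h t (hmemidx t ht.1)
    · exact (hconsQ n (idx t) h t ht).symm
  -- a window strictly beyond each time
  have hstrict : ∀ t ∈ Ici a, ∃ n : ℕ, t < a + ((n : ℝ) + 1) := fun t ht =>
    ⟨idx t + 1, by have := (hmemidx t ht).2; push_cast; linarith⟩
  -- the one-sided time derivative within `[a, ∞)` is read off a window
  have hderiv : ∀ n : ℕ, ∀ t ∈ Ico a (a + ((n : ℝ) + 1)), ∀ x,
      timeDerivWithin (Ici a) w t x = timeDerivWithin (Icc a (a + ((n : ℝ) + 1))) (W n) t x := by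
    intro n t ht x
    have h1 : timeDerivWithin (Ici a) w t x = timeDerivWithin (Ico a (a + ((n : ℝ) + 1))) w t x := by
      simp only [timeDerivWithin]
      rw [← derivWithin_inter (Iio_mem_nhds ht.2), Ici_inter_Iio]
    have h2 : timeDerivWithin (Ico a (a + ((n : ℝ) + 1))) w t x =
        timeDerivWithin (Ico a (a + ((n : ℝ) + 1))) (W n) t x :=
      timeDerivWithin_congr_of_eqOn (fun s hs => hagreeW n s (Ico_subset_Icc_self hs)) ht x
    rw [h1, h2, (hWs n).timeDerivWithin_eq_of_subset Ico_subset_Icc_self (uniqueDiffOn_Ico _ _) ht x]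
  refine ⟨w, q, isSmoothSpaceTimeOn_Ici_of_forall_window hWs hagreeW,
    isSmoothSpaceTimeOn_Ici_of_forall_window hQs hagreeQ, fun t ht => ?_, fun t ht => ?_, fun t ht => ?_,
    fun t ht x => ?_, ?_⟩
  · rw [hagreeW (idx t) t (hmemidx t ht)]; exact hWd (idx t) t (hmemidx t ht)
  · rw [hagreeW (idx t) t (hmemidx t ht)]; exact hWm (idx t) t (hmemidx t ht)
  · rw [hagreeQ (idx t) t (hmemidx t ht)]; exact hQm (idx t) t (hmemidx t ht)
  · obtain ⟨n, hn⟩ := hstrict t ht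
    have htI : t ∈ Icc a (a + ((n : ℝ) + 1)) := ⟨ht, hn.le⟩
    rw [hderiv n t ⟨ht, hn⟩ x, hagreeW n t htI, hagreeQ n t htI]
    exact hWeq n t htI x
  · have h0 : a ∈ Icc a (a + (((0 : ℕ) : ℝ) + 1)) := left_mem_Icc.2 (hlt 0).le
    rw [hagreeW 0 a h0]
    exact hW0 0

end Torus

end Literature.Analysis.FunctionSpaces

end
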